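import Mathlib
import Summits.ResolutionOfSingularities.ResolutionOfSingularities.Theorems.HomologicalConductorPersistenceKC3LowerMiddle
import HarnessLib

/-!
# Crux `Persistence` (stmt-ResolutionOfSingularities-16484), chain W4.4b — K-C3 K2 TWO-SIDED AND FACT-FREE:
# `ca(k[x,y,z,t]/(xy − z³ − t⁴)) = caᵐ = (x, y, z², zt, t²)` for every `m ≥ 4` and every field with `2 ≠ 0`

Route `ResolutionOfSingularities/HomologicalConductor`, chain W4.4b (cell `res-hironaka`), crux `Persistence`
(stmt-ResolutionOfSingularities-16484), KILL CANDIDATE K-C3 (CHAIN w44b v13.3 §V13.11), item K2.  Part 4/4 of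
res-L1-w44b-stub-2's «K2-LOWER UNCONDITIONAL»: the lower bound `(x, y, z², zt, t²) ⊆ ca⁴(A)` WITHOUT the Esentepe /
Knörrer named facts (F-DP), hence — with res-type-010's fact-free upper bound `caᵐ(A) ⊆ I·A` (p528919) — the
two-sided equality.  `[OURS · L1 w44b]`; NOT a statement of the manuscript under review (Hironaka 2017), no statement of
that manuscript is used; AI-written, weaker than expert review.

## The tower (all affine, all fact-free)

`S = k[x,y,z,t] →(σ : y ↦ x) S′ = k[x,z,t] →(π′ : x ↦ 0) k[z,t] →(θ : z ↦ −τ⁴, t ↦ τ³) k[τ]`,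
`A = S/(f)`, `f = xy − z³ − t⁴`;  `B = S′/(F′)`, `F′ = x² − z³ − t⁴ = σ f`;  `C₂ = B/(x̄) ≅ k[z,t]/(z³ + t⁴)`.

1. (part 3 + part 2) `C₂ ↪ k[τ]` with image `⊇ τ⁶ k[τ]` ⇒ **`t̄², z̄t̄, z̄² ∈ ca²(C₂)`** (the conductor `𝔠 = 𝔪²` half
   of Esentepe's Thm 4.4, elementary form `…ConductorStable`).
2. `x̄ ∈ B⁰` (`F′ ≡ −(z³+t⁴) ≠ 0 mod x`) and `x̄ ∈ ca³(B)` (`∂F′/∂x = 2x`, KEPT-PROPER p522421, `2 ≠ 0`) ⇒ QUOTIENT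
   ASCENT (part 1, p531707): **`t̄², z̄t̄, z̄² ∈ ca³(B)`**.
3. `A ↠ B` with kernel `(x̄ − ȳ)` (`exists_ringHom_middleStage`), `x̄ − ȳ ∈ A⁰` (`f ≡ F′ ≠ 0 mod x − y`) and
   `x̄ − ȳ ∈ ca⁴(A)` (`x = ∂f/∂y`, `y = ∂f/∂x`, p528919) ⇒ QUOTIENT ASCENT along a surjection
   (`mem_cohomologyAnnihilatorOfDegree_of_surjective`): **`t̄², z̄t̄, z̄² ∈ ca⁴(A)`**; with `x̄, ȳ ∈ ca⁴(A)`: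
   **`I·A ≤ ca⁴(A)`**, and with p528919 **`caᵐ(A) = I·A` (`m ≥ 4`), `ca(A) = I·A`**; the same lower bound at every
   localisation of `A` (§5).

Steps 1–2 are part 4a (`…PersistenceKC3LowerMiddle`); this file is step 3 and the assembly.

CONSEQUENCE for the chain: in the K5 vehicle `KC3Facts → ¬Persistence` the print inputs F1 (Esentepe 2020 Thm 5.4 ×2)
and F2 (Thm 4.4 + `𝔠⟨3,4⟩ = 𝔪²`) are DISCHARGED: `hca : ca(T₀) = I·T₀` follows from this file and localisation.

References (mechanism only): res-L1-w44b-plan-1 CHAIN w44b v13.3; res-type-010 p527657/p528919; res-D-pv-058 p522421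
(all OURS); H. Knörrer, Invent. Math. 88 (1987); Ö. Esentepe, J. Algebra 541 (2020) [`Esentepe2020`].
-/

noncomputable section

-- single-problem summit: the doubled namespace component `ResolutionOfSingularities` is forced
set_option linter.dupNamespace false

namespace Summit.ResolutionOfSingularities.ResolutionOfSingularities.Theorems.HomologicalConductor.KC3Lower

open MvPolynomial Literature.RingTheory.CohomologyAnnihilator
open Summit.ResolutionOfSingularities.ResolutionOfSingularities.Theorems.HomologicalConductor.KC3Upper
open Summit.ResolutionOfSingularities.ResolutionOfSingularities.Theorems.HomologicalConductor.PersistenceJacobianKept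
open Summit.ResolutionOfSingularities.ResolutionOfSingularities.Theorems.HomologicalConductor.QuotientAscent
open Summit.ResolutionOfSingularities.ResolutionOfSingularities.Theorems.HomologicalConductor.ConductorStable
open scoped nonZeroDivisors

universe u

section Tower

variable (k : Type u) [Field k]

/-! ## §3 The first stage `A = k[x,y,z,t]/(xy − z³ − t⁴)`: `A/(x̄ − ȳ) ≅ B`, `x̄ − ȳ ∈ A⁰ ∩ ca⁴(A)`, ascent -/

/-- `g − ι″(σ g) ∈ (x − y)` for `σ : y ↦ x` (onto `k[x,z,t]`) and `ι″ : x,z,t ↦ x,z,t`. [folklore] -/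
theorem sub_inclusion_sigma_mem (g : MvPolynomial (Fin 4) k) :
    g - (MvPolynomial.aeval (![X 0, X 2, X 3] : Fin 3 → MvPolynomial (Fin 4) k))
        ((MvPolynomial.aeval (![X 0, X 0, X 1, X 2] : Fin 4 → MvPolynomial (Fin 3) k)) g) ∈
      Ideal.span ({X 0 - X 1} : Set (MvPolynomial (Fin 4) k)) := by
  induction g using MvPolynomial.induction_on with
  | C r => simp
  | add p q hp hq =>
    have : p + q - (MvPolynomial.aeval (![X 0, X 2, X 3] : Fin 3 → MvPolynomial (Fin 4) k))
        ((MvPolynomial.aeval (![X 0, X 0, X 1, X 2] : Fin 4 → MvPolynomial (Fin 3) k)) (p + q)) =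
        (p - (MvPolynomial.aeval (![X 0, X 2, X 3] : Fin 3 → MvPolynomial (Fin 4) k))
          ((MvPolynomial.aeval (![X 0, X 0, X 1, X 2] : Fin 4 → MvPolynomial (Fin 3) k)) p)) +
        (q - (MvPolynomial.aeval (![X 0, X 2, X 3] : Fin 3 → MvPolynomial (Fin 4) k))
          ((MvPolynomial.aeval (![X 0, X 0, X 1, X 2] : Fin 4 → MvPolynomial (Fin 3) k)) q)) := by
      simp only [map_add]; ring
    rw [this]
    exact Ideal.add_mem _ hp hq
  | mul_X p i hp =>
    have hX : ∀ j : Fin 4, (X j : MvPolynomial (Fin 4) k) -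
        (MvPolynomial.aeval (![X 0, X 2, X 3] : Fin 3 → MvPolynomial (Fin 4) k))
          ((MvPolynomial.aeval (![X 0, X 0, X 1, X 2] : Fin 4 → MvPolynomial (Fin 3) k))
            (X j : MvPolynomial (Fin 4) k)) ∈
        Ideal.span ({X 0 - X 1} : Set (MvPolynomial (Fin 4) k)) := by
      intro j
      fin_cases j
      · simp
      · show (X 1 : MvPolynomial (Fin 4) k) - (MvPolynomial.aeval (![X 0, X 2, X 3] : Fin 3 → MvPolynomial (Fin 4) k))
          ((MvPolynomial.aeval (![X 0, X 0, X 1, X 2] : Fin 4 → MvPolynomial (Fin 3) k))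
            (X 1 : MvPolynomial (Fin 4) k)) ∈ _
        have h1 : (MvPolynomial.aeval (![X 0, X 2, X 3] : Fin 3 → MvPolynomial (Fin 4) k))
            ((MvPolynomial.aeval (![X 0, X 0, X 1, X 2] : Fin 4 → MvPolynomial (Fin 3) k))
              (X 1 : MvPolynomial (Fin 4) k)) = X 0 := by
          simp
        rw [h1, show (X 1 - X 0 : MvPolynomial (Fin 4) k) = -(X 0 - X 1) by ring]
        exact (Ideal.neg_mem_iff (Ideal.span ({X 0 - X 1} : Set (MvPolynomial (Fin 4) k)))).mpr
          (Ideal.mem_span_singleton_self (X 0 - X 1 : MvPolynomial (Fin 4) k))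
      · simp
      · simp
    have : p * X i - (MvPolynomial.aeval (![X 0, X 2, X 3] : Fin 3 → MvPolynomial (Fin 4) k))
        ((MvPolynomial.aeval (![X 0, X 0, X 1, X 2] : Fin 4 → MvPolynomial (Fin 3) k)) (p * X i)) =
        (p - (MvPolynomial.aeval (![X 0, X 2, X 3] : Fin 3 → MvPolynomial (Fin 4) k))
          ((MvPolynomial.aeval (![X 0, X 0, X 1, X 2] : Fin 4 → MvPolynomial (Fin 3) k)) p)) * X i +
        (MvPolynomial.aeval (![X 0, X 2, X 3] : Fin 3 → MvPolynomial (Fin 4) k))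
          ((MvPolynomial.aeval (![X 0, X 0, X 1, X 2] : Fin 4 → MvPolynomial (Fin 3) k)) p) *
          (X i - (MvPolynomial.aeval (![X 0, X 2, X 3] : Fin 3 → MvPolynomial (Fin 4) k))
            ((MvPolynomial.aeval (![X 0, X 0, X 1, X 2] : Fin 4 → MvPolynomial (Fin 3) k))
              (X i : MvPolynomial (Fin 4) k))) := by
      simp only [map_mul]
      ring
    rw [this]
    exact Ideal.add_mem _ (Ideal.mul_mem_right _ _ hp) (Ideal.mul_mem_left _ _ (hX i))

/-- `σ f = F′`: `(xy − z³ − t⁴)|_{y = x} = x² − z³ − t⁴`. [folklore] -/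
theorem sigma_f :
    (MvPolynomial.aeval (![X 0, X 0, X 1, X 2] : Fin 4 → MvPolynomial (Fin 3) k))
        (X 0 * X 1 - X 2 ^ 3 - X 3 ^ 4 : MvPolynomial (Fin 4) k) = X 0 ^ 2 - X 1 ^ 3 - X 2 ^ 4 := by
  simp
  ring

/-- `ι″ F′ = f + x (x − y)`. [folklore] -/
theorem inclusion_F' :
    (MvPolynomial.aeval (![X 0, X 2, X 3] : Fin 3 → MvPolynomial (Fin 4) k))
        (X 0 ^ 2 - X 1 ^ 3 - X 2 ^ 4 : MvPolynomial (Fin 3) k) =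
      (X 0 * X 1 - X 2 ^ 3 - X 3 ^ 4) + X 0 * (X 0 - X 1) := by
  simp
  ring

/-- `σ ∘ ι″ = id` on `k[x,z,t]`. [folklore] -/
theorem sigma_comp_inclusion (s : MvPolynomial (Fin 3) k) :
    (MvPolynomial.aeval (![X 0, X 0, X 1, X 2] : Fin 4 → MvPolynomial (Fin 3) k))
      ((MvPolynomial.aeval (![X 0, X 2, X 3] : Fin 3 → MvPolynomial (Fin 4) k)) s) = s := by
  have h : (MvPolynomial.aeval (![X 0, X 0, X 1, X 2] : Fin 4 → MvPolynomial (Fin 3) k)).comp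
      (MvPolynomial.aeval (![X 0, X 2, X 3] : Fin 3 → MvPolynomial (Fin 4) k)) = AlgHom.id k _ := by
    refine MvPolynomial.algHom_ext fun i => ?_
    fin_cases i <;> simp
  exact AlgHom.congr_fun h s

/-- `x̄ − ȳ` is a non-zero-divisor of `A = k[x,y,z,t]/(xy − z³ − t⁴)` (`f ≡ F′ ≠ 0 mod x − y`). [folklore] -/
theorem mk_X0_sub_X1_mem_nonZeroDivisors :
    Ideal.Quotient.mk (Ideal.span ({X 0 * X 1 - X 2 ^ 3 - X 3 ^ 4} : Set (MvPolynomial (Fin 4) k))) (X 0 - X 1) ∈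
      (MvPolynomial (Fin 4) k ⧸ Ideal.span ({X 0 * X 1 - X 2 ^ 3 - X 3 ^ 4} : Set (MvPolynomial (Fin 4) k)))⁰ := by
  refine mk_mem_nonZeroDivisors_of_ringHom
    (MvPolynomial.aeval (![X 0, X 0, X 1, X 2] : Fin 4 → MvPolynomial (Fin 3) k)).toRingHom
    (mem_nonZeroDivisors_of_ne_zero ?_) (by simp) (fun q hq => ?_) ?_
  · intro h
    have h' := congrArg (MvPolynomial.eval (![1, 0, 0, 0] : Fin 4 → k)) h
    simp at h'
  · have h := sub_inclusion_sigma_mem k q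
    rw [AlgHom.toRingHom_eq_coe, RingHom.coe_coe] at hq
    rw [hq, map_zero, sub_zero] at h
    exact Ideal.mem_span_singleton.mp h
  · rw [AlgHom.toRingHom_eq_coe, RingHom.coe_coe, sigma_f]
    exact mem_nonZeroDivisors_of_ne_zero (F'_ne_zero k)

/-- `x̄ − ȳ ∈ ca⁴(A)` (`x = ∂f/∂y`, `y = ∂f/∂x`: res-type-010 p528919 / res-D-pv-058 p522421). [folklore] -/
theorem mk_X0_sub_X1_mem_cohomologyAnnihilatorOfDegree_four :
    Ideal.Quotient.mk (Ideal.span ({X 0 * X 1 - X 2 ^ 3 - X 3 ^ 4} : Set (MvPolynomial (Fin 4) k))) (X 0 - X 1) ∈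
      cohomologyAnnihilatorOfDegree (MvPolynomial (Fin 4) k ⧸
        Ideal.span ({X 0 * X 1 - X 2 ^ 3 - X 3 ^ 4} : Set (MvPolynomial (Fin 4) k))) 4 := by
  rw [map_sub]
  exact Ideal.sub_mem _ (mk_X0_mem_cohomologyAnnihilatorOfDegree_four k)
    (mk_X1_mem_cohomologyAnnihilatorOfDegree_four k)

/-- **The presentation `A ↠ B`**: the substitution `σ : y ↦ x` induces a SURJECTIVE ring map
`Ψ : A = k[x,y,z,t]/(f) → B = k[x,z,t]/(F′)` with `ker Ψ = (x̄ − ȳ)` (so `A/(x̄ − ȳ) ≅ B`), recorded by its values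
`Ψ (ḡ) = (σ g)‾`. [OURS · L1 w44b] -/
theorem exists_ringHom_middleStage (f : MvPolynomial (Fin 4) k) (hf : f = X 0 * X 1 - X 2 ^ 3 - X 3 ^ 4) :
    ∃ Ψ : (MvPolynomial (Fin 4) k ⧸ Ideal.span ({f} : Set (MvPolynomial (Fin 4) k))) →+*
        (MvPolynomial (Fin 3) k ⧸ Ideal.span ({X 0 ^ 2 - X 1 ^ 3 - X 2 ^ 4} : Set (MvPolynomial (Fin 3) k))),
      Function.Surjective Ψ ∧
      RingHom.ker Ψ = Ideal.span {Ideal.Quotient.mk _ (X 0 - X 1)} ∧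
      ∀ g : MvPolynomial (Fin 4) k, Ψ (Ideal.Quotient.mk _ g) =
        Ideal.Quotient.mk _ ((MvPolynomial.aeval (![X 0, X 0, X 1, X 2] : Fin 4 → MvPolynomial (Fin 3) k)) g) := by
  subst hf
  set Ψ₀ : MvPolynomial (Fin 4) k →+*
      (MvPolynomial (Fin 3) k ⧸ Ideal.span ({X 0 ^ 2 - X 1 ^ 3 - X 2 ^ 4} : Set (MvPolynomial (Fin 3) k))) :=
    (Ideal.Quotient.mk _).comp
      (MvPolynomial.aeval (![X 0, X 0, X 1, X 2] : Fin 4 → MvPolynomial (Fin 3) k)).toRingHom with hΨ₀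
  have hΨ₀_apply : ∀ g, Ψ₀ g =
      Ideal.Quotient.mk _ ((MvPolynomial.aeval (![X 0, X 0, X 1, X 2] : Fin 4 → MvPolynomial (Fin 3) k)) g) :=
    fun g => rfl
  have hΨ₀f : ∀ a ∈ Ideal.span ({X 0 * X 1 - X 2 ^ 3 - X 3 ^ 4} : Set (MvPolynomial (Fin 4) k)), Ψ₀ a = 0 := by
    intro a ha
    obtain ⟨v, rfl⟩ := Ideal.mem_span_singleton'.mp ha
    rw [map_mul, hΨ₀_apply (X 0 * X 1 - X 2 ^ 3 - X 3 ^ 4), sigma_f,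
      Ideal.Quotient.eq_zero_iff_mem.mpr (Ideal.mem_span_singleton_self _), mul_zero]
  set Ψ := Ideal.Quotient.lift _ Ψ₀ hΨ₀f with hΨ
  have hΨ_mk : ∀ g, Ψ (Ideal.Quotient.mk _ g) = Ψ₀ g := fun g => Ideal.Quotient.lift_mk _ _ _
  refine ⟨Ψ, ?_, ?_, fun g => by rw [hΨ_mk, hΨ₀_apply]⟩
  · -- surjective: `σ ∘ ι″ = id`
    intro u
    obtain ⟨g, rfl⟩ := Ideal.Quotient.mk_surjective u
    exact ⟨Ideal.Quotient.mk _ ((MvPolynomial.aeval (![X 0, X 2, X 3] : Fin 3 → MvPolynomial (Fin 4) k)) g),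
      by rw [hΨ_mk, hΨ₀_apply, sigma_comp_inclusion]⟩
  · -- kernel: `σ g ∈ (F′) ⇒ g ∈ (x − y) + (f)`
    apply le_antisymm
    · intro u hu
      obtain ⟨g, rfl⟩ := Ideal.Quotient.mk_surjective u
      rw [RingHom.mem_ker, hΨ_mk, hΨ₀_apply, Ideal.Quotient.eq_zero_iff_mem, Ideal.mem_span_singleton'] at hu
      obtain ⟨r, hr⟩ := hu
      -- `g − ι″ r · f ∈ (x − y)`
      have hmem : g - (MvPolynomial.aeval (![X 0, X 2, X 3] : Fin 3 → MvPolynomial (Fin 4) k)) r *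
          (X 0 * X 1 - X 2 ^ 3 - X 3 ^ 4) ∈ Ideal.span ({X 0 - X 1} : Set (MvPolynomial (Fin 4) k)) := by
        have h1 := sub_inclusion_sigma_mem k g
        rw [← hr, map_mul, inclusion_F'] at h1
        have hid : g - (MvPolynomial.aeval (![X 0, X 2, X 3] : Fin 3 → MvPolynomial (Fin 4) k)) r *
            (X 0 * X 1 - X 2 ^ 3 - X 3 ^ 4) =
            (g - (MvPolynomial.aeval (![X 0, X 2, X 3] : Fin 3 → MvPolynomial (Fin 4) k)) r *
              ((X 0 * X 1 - X 2 ^ 3 - X 3 ^ 4) + X 0 * (X 0 - X 1))) +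
            (MvPolynomial.aeval (![X 0, X 2, X 3] : Fin 3 → MvPolynomial (Fin 4) k)) r * X 0 * (X 0 - X 1) := by
          ring
        rw [hid]
        exact Ideal.add_mem _ h1 (Ideal.mul_mem_left _ _ (Ideal.mem_span_singleton_self _))
      have heq : Ideal.Quotient.mk (Ideal.span ({X 0 * X 1 - X 2 ^ 3 - X 3 ^ 4} : Set (MvPolynomial (Fin 4) k))) g =
          Ideal.Quotient.mk _ (g - (MvPolynomial.aeval (![X 0, X 2, X 3] : Fin 3 → MvPolynomial (Fin 4) k)) r *
            (X 0 * X 1 - X 2 ^ 3 - X 3 ^ 4)) := by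
        rw [Ideal.Quotient.eq]
        have : g - (g - (MvPolynomial.aeval (![X 0, X 2, X 3] : Fin 3 → MvPolynomial (Fin 4) k)) r *
            (X 0 * X 1 - X 2 ^ 3 - X 3 ^ 4)) =
            (MvPolynomial.aeval (![X 0, X 2, X 3] : Fin 3 → MvPolynomial (Fin 4) k)) r *
              (X 0 * X 1 - X 2 ^ 3 - X 3 ^ 4) := by ring
        rw [this]
        exact Ideal.mul_mem_left _ _ (Ideal.mem_span_singleton_self _)
      have hmap : (Ideal.span ({X 0 - X 1} : Set (MvPolynomial (Fin 4) k))).map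
          (Ideal.Quotient.mk (Ideal.span ({X 0 * X 1 - X 2 ^ 3 - X 3 ^ 4} : Set (MvPolynomial (Fin 4) k)))) =
          Ideal.span {Ideal.Quotient.mk
            (Ideal.span ({X 0 * X 1 - X 2 ^ 3 - X 3 ^ 4} : Set (MvPolynomial (Fin 4) k))) (X 0 - X 1)} := by
        rw [Ideal.map_span, Set.image_singleton]
      rw [heq, ← hmap]
      exact Ideal.mem_map_of_mem _ hmem
    · rw [Ideal.span_le, Set.singleton_subset_iff, SetLike.mem_coe, RingHom.mem_ker, hΨ_mk, hΨ₀_apply]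
      simp

/-- **First stage (lower bound, the three new generators)**: `t̄², z̄t̄, z̄² ∈ ca⁴(k[x,y,z,t]/(xy − z³ − t⁴))` for every
field `k` with `2 ≠ 0` — FACT-FREE (no Esentepe / Knörrer named fact). [OURS · L1 w44b] -/
theorem mem_cohomologyAnnihilatorOfDegree_four_of_eq (h2 : (2 : k) ≠ 0) (c : MvPolynomial (Fin 4) k)
    (hc : c = X 3 ^ 2 ∨ c = X 2 * X 3 ∨ c = X 2 ^ 2) :
    Ideal.Quotient.mk (Ideal.span ({X 0 * X 1 - X 2 ^ 3 - X 3 ^ 4} : Set (MvPolynomial (Fin 4) k))) c ∈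
      cohomologyAnnihilatorOfDegree (MvPolynomial (Fin 4) k ⧸
        Ideal.span ({X 0 * X 1 - X 2 ^ 3 - X 3 ^ 4} : Set (MvPolynomial (Fin 4) k))) 4 := by
  -- the corresponding element of `k[x,z,t]`
  obtain ⟨c', hc', hcc'⟩ : ∃ c' : MvPolynomial (Fin 3) k, (c' = X 2 ^ 2 ∨ c' = X 1 * X 2 ∨ c' = X 1 ^ 2) ∧
      (MvPolynomial.aeval (![X 0, X 2, X 3] : Fin 3 → MvPolynomial (Fin 4) k)) c' = c := by
    rcases hc with rfl | rfl | rfl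
    · exact ⟨X 2 ^ 2, Or.inl rfl, by simp⟩
    · exact ⟨X 1 * X 2, Or.inr (Or.inl rfl), by simp⟩
    · exact ⟨X 1 ^ 2, Or.inr (Or.inr rfl), by simp⟩
  have hB := mem_cohomologyAnnihilatorOfDegree_three_middleStage k h2 c' hc'
  obtain ⟨Ψ, hsurj, hker, hΨ⟩ := exists_ringHom_middleStage k _ rfl
  have hσc : (MvPolynomial.aeval (![X 0, X 0, X 1, X 2] : Fin 4 → MvPolynomial (Fin 3) k)) c = c' := by
    rw [← hcc', sigma_comp_inclusion]
  refine mem_cohomologyAnnihilatorOfDegree_of_surjective Ψ hsurj hker (mk_X0_sub_X1_mem_nonZeroDivisors k)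
    (m := 2) (mk_X0_sub_X1_mem_cohomologyAnnihilatorOfDegree_four k) ?_
  rw [hΨ, hσc]
  exact hB

/-- `t̄² ∈ ca⁴(A)`. [OURS · L1 w44b] -/
theorem mk_X3_sq_mem_cohomologyAnnihilatorOfDegree_four (h2 : (2 : k) ≠ 0) :
    Ideal.Quotient.mk (Ideal.span ({X 0 * X 1 - X 2 ^ 3 - X 3 ^ 4} : Set (MvPolynomial (Fin 4) k))) (X 3 ^ 2) ∈
      cohomologyAnnihilatorOfDegree (MvPolynomial (Fin 4) k ⧸
        Ideal.span ({X 0 * X 1 - X 2 ^ 3 - X 3 ^ 4} : Set (MvPolynomial (Fin 4) k))) 4 :=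
  mem_cohomologyAnnihilatorOfDegree_four_of_eq k h2 _ (Or.inl rfl)

/-- `z̄t̄ ∈ ca⁴(A)`. [OURS · L1 w44b] -/
theorem mk_X2_mul_X3_mem_cohomologyAnnihilatorOfDegree_four (h2 : (2 : k) ≠ 0) :
    Ideal.Quotient.mk (Ideal.span ({X 0 * X 1 - X 2 ^ 3 - X 3 ^ 4} : Set (MvPolynomial (Fin 4) k))) (X 2 * X 3) ∈
      cohomologyAnnihilatorOfDegree (MvPolynomial (Fin 4) k ⧸
        Ideal.span ({X 0 * X 1 - X 2 ^ 3 - X 3 ^ 4} : Set (MvPolynomial (Fin 4) k))) 4 :=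
  mem_cohomologyAnnihilatorOfDegree_four_of_eq k h2 _ (Or.inr (Or.inl rfl))

/-- `z̄² ∈ ca⁴(A)` (no `3 ≠ 0` needed: the conductor, not the Jacobian, supplies it). [OURS · L1 w44b] -/
theorem mk_X2_sq_mem_cohomologyAnnihilatorOfDegree_four (h2 : (2 : k) ≠ 0) :
    Ideal.Quotient.mk (Ideal.span ({X 0 * X 1 - X 2 ^ 3 - X 3 ^ 4} : Set (MvPolynomial (Fin 4) k))) (X 2 ^ 2) ∈
      cohomologyAnnihilatorOfDegree (MvPolynomial (Fin 4) k ⧸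
        Ideal.span ({X 0 * X 1 - X 2 ^ 3 - X 3 ^ 4} : Set (MvPolynomial (Fin 4) k))) 4 :=
  mem_cohomologyAnnihilatorOfDegree_four_of_eq k h2 _ (Or.inr (Or.inr rfl))

/-! ## §4 K2 two-sided: `I·A ≤ ca⁴(A) ≤ caᵐ(A) ≤ I·A` -/

/-- **K2-LOWER, fact-free**: `(x, y, z², zt, t²)·A ≤ ca⁴(A)`, `A = k[x,y,z,t]/(xy − z³ − t⁴)`, every field `k` with
`2 ≠ 0`. [OURS · L1 w44b] -/
theorem map_I_le_cohomologyAnnihilatorOfDegree_four (h2 : (2 : k) ≠ 0) :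
    (Ideal.span ({X 0, X 1, X 2 ^ 2, X 2 * X 3, X 3 ^ 2} : Set (MvPolynomial (Fin 4) k))).map
        (Ideal.Quotient.mk (Ideal.span ({X 0 * X 1 - X 2 ^ 3 - X 3 ^ 4} : Set (MvPolynomial (Fin 4) k)))) ≤
      cohomologyAnnihilatorOfDegree (MvPolynomial (Fin 4) k ⧸
        Ideal.span ({X 0 * X 1 - X 2 ^ 3 - X 3 ^ 4} : Set (MvPolynomial (Fin 4) k))) 4 := by
  rw [Ideal.map_span, Ideal.span_le]
  rintro _ ⟨g, hg, rfl⟩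
  simp only [Set.mem_insert_iff, Set.mem_singleton_iff] at hg
  rcases hg with rfl | rfl | rfl | rfl | rfl
  · exact mk_X0_mem_cohomologyAnnihilatorOfDegree_four k
  · exact mk_X1_mem_cohomologyAnnihilatorOfDegree_four k
  · exact mk_X2_sq_mem_cohomologyAnnihilatorOfDegree_four k h2
  · exact mk_X2_mul_X3_mem_cohomologyAnnihilatorOfDegree_four k h2
  · exact mk_X3_sq_mem_cohomologyAnnihilatorOfDegree_four k h2

/-- `I·A ≤ caᵐ(A)` for every `m ≥ 4`. [OURS · L1 w44b] -/
theorem map_I_le_cohomologyAnnihilatorOfDegree (h2 : (2 : k) ≠ 0) {m : ℕ} (hm : 4 ≤ m) :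
    (Ideal.span ({X 0, X 1, X 2 ^ 2, X 2 * X 3, X 3 ^ 2} : Set (MvPolynomial (Fin 4) k))).map
        (Ideal.Quotient.mk (Ideal.span ({X 0 * X 1 - X 2 ^ 3 - X 3 ^ 4} : Set (MvPolynomial (Fin 4) k)))) ≤
      cohomologyAnnihilatorOfDegree (MvPolynomial (Fin 4) k ⧸
        Ideal.span ({X 0 * X 1 - X 2 ^ 3 - X 3 ^ 4} : Set (MvPolynomial (Fin 4) k))) m :=
  (map_I_le_cohomologyAnnihilatorOfDegree_four k h2).trans (cohomologyAnnihilatorOfDegree_mono hm)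

/-- `I·A ≤ ca(A)`. [OURS · L1 w44b] -/
theorem map_I_le_cohomologyAnnihilator (h2 : (2 : k) ≠ 0) :
    (Ideal.span ({X 0, X 1, X 2 ^ 2, X 2 * X 3, X 3 ^ 2} : Set (MvPolynomial (Fin 4) k))).map
        (Ideal.Quotient.mk (Ideal.span ({X 0 * X 1 - X 2 ^ 3 - X 3 ^ 4} : Set (MvPolynomial (Fin 4) k)))) ≤
      cohomologyAnnihilator (MvPolynomial (Fin 4) k ⧸
        Ideal.span ({X 0 * X 1 - X 2 ^ 3 - X 3 ^ 4} : Set (MvPolynomial (Fin 4) k))) :=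
  (map_I_le_cohomologyAnnihilatorOfDegree_four k h2).trans (cohomologyAnnihilatorOfDegree_le 4)

/-- **K2 TWO-SIDED, FACT-FREE: `caᵐ(A) = (x, y, z², zt, t²)·A` for every `m ≥ 4`**, `A = k[x,y,z,t]/(xy − z³ − t⁴)`,
every field `k` with `2 ≠ 0` (lower bound: this file; upper bound: res-type-010 p528919). [OURS · L1 w44b] -/
theorem cohomologyAnnihilatorOfDegree_eq_map_I (h2 : (2 : k) ≠ 0) {m : ℕ} (hm : 4 ≤ m) :
    cohomologyAnnihilatorOfDegree (MvPolynomial (Fin 4) k ⧸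
        Ideal.span ({X 0 * X 1 - X 2 ^ 3 - X 3 ^ 4} : Set (MvPolynomial (Fin 4) k))) m =
      (Ideal.span ({X 0, X 1, X 2 ^ 2, X 2 * X 3, X 3 ^ 2} : Set (MvPolynomial (Fin 4) k))).map
        (Ideal.Quotient.mk (Ideal.span ({X 0 * X 1 - X 2 ^ 3 - X 3 ^ 4} : Set (MvPolynomial (Fin 4) k)))) :=
  le_antisymm (cohomologyAnnihilatorOfDegree_le_map_I k m) (map_I_le_cohomologyAnnihilatorOfDegree k h2 hm)

/-- **`ca(A) = (x, y, z², zt, t²)·A`**, `A = k[x,y,z,t]/(xy − z³ − t⁴)`, every field `k` with `2 ≠ 0` — the K-C3 item K2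
at the affine ring, two-sided and unconditional. [OURS · L1 w44b] -/
theorem cohomologyAnnihilator_eq_map_I (h2 : (2 : k) ≠ 0) :
    cohomologyAnnihilator (MvPolynomial (Fin 4) k ⧸
        Ideal.span ({X 0 * X 1 - X 2 ^ 3 - X 3 ^ 4} : Set (MvPolynomial (Fin 4) k))) =
      (Ideal.span ({X 0, X 1, X 2 ^ 2, X 2 * X 3, X 3 ^ 2} : Set (MvPolynomial (Fin 4) k))).map
        (Ideal.Quotient.mk (Ideal.span ({X 0 * X 1 - X 2 ^ 3 - X 3 ^ 4} : Set (MvPolynomial (Fin 4) k)))) :=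
  le_antisymm (cohomologyAnnihilator_le_map_I k) (map_I_le_cohomologyAnnihilator k h2)

/-- `ca(A) = ca⁴(A)` (saturation at level `4 = dim S`), as a by-product. [OURS · L1 w44b] -/
theorem cohomologyAnnihilator_eq_cohomologyAnnihilatorOfDegree_four (h2 : (2 : k) ≠ 0) :
    cohomologyAnnihilator (MvPolynomial (Fin 4) k ⧸
        Ideal.span ({X 0 * X 1 - X 2 ^ 3 - X 3 ^ 4} : Set (MvPolynomial (Fin 4) k))) =
      cohomologyAnnihilatorOfDegree (MvPolynomial (Fin 4) k ⧸
        Ideal.span ({X 0 * X 1 - X 2 ^ 3 - X 3 ^ 4} : Set (MvPolynomial (Fin 4) k))) 4 := by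
  rw [cohomologyAnnihilator_eq_map_I k h2, cohomologyAnnihilatorOfDegree_eq_map_I k h2 le_rfl]

/-! ## §5 Local rings of `A` (e.g. `T₀ = A_𝔪`): the lower bound ascends along any localisation -/

/-- **K2-LOWER at every localisation of `A`** (in particular at the local ring `T₀ = A_𝔪` of the K-C3 tower):
`(x, y, z², zt, t²)·T ≤ ca⁴(T)` for any `IsLocalization M T` over `A = k[x,y,z,t]/(xy − z³ − t⁴)`, `2 ≠ 0` in `k`
(tree `map_cohomologyAnnihilatorOfDegree_le_of_isLocalization`, [IyengarTakahashi2014, Lemma 2.10(1)]). [OURS · L1 w44b] -/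
theorem map_map_I_le_cohomologyAnnihilatorOfDegree_four_of_isLocalization (h2 : (2 : k) ≠ 0)
    (M : Submonoid (MvPolynomial (Fin 4) k ⧸
      Ideal.span ({X 0 * X 1 - X 2 ^ 3 - X 3 ^ 4} : Set (MvPolynomial (Fin 4) k))))
    (T : Type u) [CommRing T]
    [Algebra (MvPolynomial (Fin 4) k ⧸ Ideal.span ({X 0 * X 1 - X 2 ^ 3 - X 3 ^ 4} : Set (MvPolynomial (Fin 4) k))) T]
    [IsLocalization M T] :
    ((Ideal.span ({X 0, X 1, X 2 ^ 2, X 2 * X 3, X 3 ^ 2} : Set (MvPolynomial (Fin 4) k))).map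
        (Ideal.Quotient.mk (Ideal.span ({X 0 * X 1 - X 2 ^ 3 - X 3 ^ 4} : Set (MvPolynomial (Fin 4) k))))).map
        (algebraMap (MvPolynomial (Fin 4) k ⧸
          Ideal.span ({X 0 * X 1 - X 2 ^ 3 - X 3 ^ 4} : Set (MvPolynomial (Fin 4) k))) T) ≤
      cohomologyAnnihilatorOfDegree T 4 :=
  (Ideal.map_mono (map_I_le_cohomologyAnnihilatorOfDegree_four k h2)).trans
    (map_cohomologyAnnihilatorOfDegree_le_of_isLocalization M T 4)

/-- `ca`-form at every localisation: `(x, y, z², zt, t²)·T ≤ ca(T)`. [OURS · L1 w44b] -/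
theorem map_map_I_le_cohomologyAnnihilator_of_isLocalization (h2 : (2 : k) ≠ 0)
    (M : Submonoid (MvPolynomial (Fin 4) k ⧸
      Ideal.span ({X 0 * X 1 - X 2 ^ 3 - X 3 ^ 4} : Set (MvPolynomial (Fin 4) k))))
    (T : Type u) [CommRing T]
    [Algebra (MvPolynomial (Fin 4) k ⧸ Ideal.span ({X 0 * X 1 - X 2 ^ 3 - X 3 ^ 4} : Set (MvPolynomial (Fin 4) k))) T]
    [IsLocalization M T] :
    ((Ideal.span ({X 0, X 1, X 2 ^ 2, X 2 * X 3, X 3 ^ 2} : Set (MvPolynomial (Fin 4) k))).map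
        (Ideal.Quotient.mk (Ideal.span ({X 0 * X 1 - X 2 ^ 3 - X 3 ^ 4} : Set (MvPolynomial (Fin 4) k))))).map
        (algebraMap (MvPolynomial (Fin 4) k ⧸
          Ideal.span ({X 0 * X 1 - X 2 ^ 3 - X 3 ^ 4} : Set (MvPolynomial (Fin 4) k))) T) ≤
      cohomologyAnnihilator T :=
  (map_map_I_le_cohomologyAnnihilatorOfDegree_four_of_isLocalization k h2 M T).trans
    (cohomologyAnnihilatorOfDegree_le 4)

end Tower

end Summit.ResolutionOfSingularities.ResolutionOfSingularities.Theorems.HomologicalConductor.KC3Lower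

end
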